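import Literature.NumberTheory.Automorphic.HilbertRepMultiplicitySpaceSchur
import Literature.NumberTheory.Automorphic.CompactGroupMultiplicitySpace
import Literature.NumberTheory.Automorphic.CompactGroupKTypeMultiplicity
import Literature.NumberTheory.Automorphic.ProductGroupTensorHomMultiplicity
import HarnessLib

/-!
# `multiplicity π τ = dim Hom_G(τ, π)` for ANY group — no compactness, no continuity

Topic `Literature/NumberTheory/Automorphic` (`HilbertRepSpectrum` vocabulary); theorems only, no definition, no named fact.

`CompactGroupKTypeMultiplicity` proved `dim X_τ(π) = dim τ · dim Hom_G(τ, π)` and `multiplicity π τ = dim Hom_G(τ, π)` for a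
unitary strongly continuous representation of a COMPACT group (through the character projection).  The Schur-orthogonality
identity `⟪S f, T f'⟫ = ⟪S, T⟫ ⟪f, f'⟫ / dim τ` of `HilbertRepMultiplicitySpaceSchur` makes the evaluation map
`Hom_G(τ, π) ⊗ V_τ → X` injective for ANY group `G` and any unitary `π` (no topology on `G`, no continuity of `π` or `τ`), and
`CompactGroupMultiplicitySpace` shows it is onto `X_τ(π)` when the isotype is finite-dimensional; so the dimension count and
Bröcker–tom Dieck's definition II (1.13) «we call the dimension `dim_ℂ Hom_G(W, V)` the multiplicity of `W` in `V`» agree with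
the `HilbertRepSpectrum` multiplicity in this generality (Deitmar–Echterhoff Thm. 7.3.2: `V_π(τ)` is a direct sum of
`dim Hom_K(V_τ, V_π)` copies of `V_τ`).

* `injective_lift_eval_intertwiners` — the evaluation map on `Schur.intertwiners τ π ⊗ V_τ` is injective (any group);
* `exists_linearEquiv_intertwiners_tensor_isotypicComponent'` — **`Hom_G(τ, π) ⊗ V_τ ≃ₗ X_τ(π)`** for a finite-dimensional
  isotype, any group (the compact case is `exists_linearEquiv_intertwiners_tensor_isotypicComponent`);
* `finrank_isotypicComponent_eq_finrank_mul_finrank_intertwiners'` — **`dim X_τ(π) = dim τ · dim Hom_G(τ, π)`**;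
* `multiplicity_eq_finrank_intertwiners''`, `multiplicity_eq_finrank_intertwiners_or'` —
  **`multiplicity π τ = dim Hom_G(τ, π)`** (`⊤` iff `Hom_G(τ, π)` is infinite-dimensional), any group;
* `multiplicity_eq_finrank_homSpace` — the same with the Hilbert–Schmidt model `ContRepresentation.HomSpace`;
* `multiplicity_outerTensor_eq_multiplicity_homRep'` — **`mult(π ⊗ τ, U) = mult(π, Θ(τ))` for ANY groups `G`, `H`**
  (the compact case is `multiplicity_outerTensor_eq_multiplicity_homRep`, `ProductGroupTensorHomMultiplicity`);
* `intertwiners_eq_bot_iff_isotypicComponent_eq_bot`, `multiplicity_eq_zero_iff_intertwiners_eq_bot`,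
  `multiplicity_ne_zero_iff_nontrivial_intertwiners`, `nontrivial_homSpace_iff_multiplicity_ne_zero` — **`τ` occurs in `π`
  iff `Hom_G(τ, π) ≠ 0`** (any group).

## References
* T. Bröcker, T. tom Dieck, *Representations of Compact Lie Groups*, GTM 98 (1985), II (1.13)–(1.14), (4.14), PDF pp. 69, 80
  [BrockerTomDieck1985].
* A. Deitmar, S. Echterhoff, *Principles of Harmonic Analysis*, 2nd ed. (2014), §7.3 Lemma 7.3.1, Thm. 7.3.2, PDF pp. 197–199
  [DeitmarEchterhoff2014].

## Provenance
Lane `lit-hodgefound` (HOME `run/shared/lean/pub/lit-hodgefound/`), prover seat `lit-hodgefound-p05` generation 7 (Layer 0,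
beneath C2-08 / C2-10: `K`-type multiplicities without compactness of the ambient group).
-/

noncomputable section

open ContinuousLinearMap
open Literature.RepresentationTheory.CompactGroups Literature.NumberTheory.Automorphic
open scoped InnerProductSpace TensorProduct

namespace ContRepresentation

section AnyGroup

variable {G : Type*} [Group G]
variable {X : Type*} [NormedAddCommGroup X] [InnerProductSpace ℂ X] [CompleteSpace X]
variable {E : Type*} [NormedAddCommGroup E] [InnerProductSpace ℂ E] [FiniteDimensional ℂ E]
variable {π : ContRepresentation ℂ G X} {τ : ContRepresentation ℂ G E}

/-- **The evaluation map `Hom_G(τ, π) ⊗ V_τ → X`, `T ⊗ f ↦ T f`, is injective** for `τ` irreducible unitary and `π` unitary —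
any group, no continuity (`HomSpace.injective_lift_eval` read on `Schur.intertwiners`).
[cite: DeitmarEchterhoff2014, Lemma 7.3.1] [cite: BrockerTomDieck1985, II Prop (1.14)] -/
theorem injective_lift_eval_intertwiners (hπu : π.IsUnitary) [τ.toRepresentation.IsIrreducible]
    (hτu : ∀ (g : G) (v w : E), ⟪τ g v, τ g w⟫_ℂ = ⟪v, w⟫_ℂ) :
    Function.Injective (TensorProduct.lift ((ContinuousLinearMap.coeLM ℂ).comp (Schur.intertwiners τ π).subtype)) :=
  HomSpace.injective_lift_eval (τ := τ) (ρ := π) hπu hτu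

/-- **`Hom_G(τ, π) ⊗ V_τ ≃ₗ X_τ(π)` via `T ⊗ f ↦ T f`**, for a finite-dimensional isotype — ANY group, `π` unitary, `τ`
irreducible unitary: injective by Schur orthogonality, onto by `range_lift_eval_eq_isotypicComponent`.
[cite: BrockerTomDieck1985, II Prop (1.14)] [cite: DeitmarEchterhoff2014, Thm. 7.3.2] -/
theorem exists_linearEquiv_intertwiners_tensor_isotypicComponent' (hπu : π.IsUnitary) [τ.toRepresentation.IsIrreducible]
    (hτu : ∀ (g : G) (v w : E), ⟪τ g v, τ g w⟫_ℂ = ⟪v, w⟫_ℂ) [FiniteDimensional ℂ (π.isotypicComponent τ).toSubmodule] :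
    ∃ Ψ : (Schur.intertwiners τ π ⊗[ℂ] E) ≃ₗ[ℂ] (π.isotypicComponent τ).toSubmodule,
      ∀ (T : Schur.intertwiners τ π) (f : E), (Ψ (T ⊗ₜ[ℂ] f) : X) = (T : E →L[ℂ] X) f := by
  set ev := TensorProduct.lift ((ContinuousLinearMap.coeLM ℂ).comp (Schur.intertwiners τ π).subtype) with hev
  have hrange : LinearMap.range ev = (π.isotypicComponent τ).toSubmodule :=
    range_lift_eval_eq_isotypicComponent hπu hτu
  obtain ⟨ev', hev'⟩ : ∃ ev' : (Schur.intertwiners τ π ⊗[ℂ] E) →ₗ[ℂ] (π.isotypicComponent τ).toSubmodule,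
      ∀ x, (ev' x : X) = ev x :=
    ⟨LinearMap.codRestrict _ ev fun x => hrange.le (LinearMap.mem_range_self ev x), fun _ => rfl⟩
  have hsurj : Function.Surjective ev' := by
    rintro ⟨y, hy⟩
    obtain ⟨x, rfl⟩ := hrange.ge hy
    exact ⟨x, Subtype.ext (hev' x)⟩
  have hinj : Function.Injective ev' := fun x y hxy => by
    have h : ev x = ev y := by rw [← hev', ← hev', hxy]
    exact injective_lift_eval_intertwiners hπu hτu h
  refine ⟨LinearEquiv.ofBijective ev' ⟨hinj, hsurj⟩, fun T f => ?_⟩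
  rw [LinearEquiv.ofBijective_apply, hev', lift_eval_tmul]

/-- **`dim X_τ(π) = dim τ · dim Hom_G(τ, π)` for ANY group** (`π` unitary on a Hilbert space, `τ` irreducible unitary,
finite-dimensional isotype) — Bröcker–tom Dieck II (1.14) / Deitmar–Echterhoff Thm. 7.3.2 without compactness or
continuity. [cite: BrockerTomDieck1985, II Prop (1.14)] [cite: DeitmarEchterhoff2014, Thm. 7.3.2] -/
theorem finrank_isotypicComponent_eq_finrank_mul_finrank_intertwiners' (hπu : π.IsUnitary)
    [τ.toRepresentation.IsIrreducible] (hτu : ∀ (g : G) (v w : E), ⟪τ g v, τ g w⟫_ℂ = ⟪v, w⟫_ℂ)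
    [FiniteDimensional ℂ (π.isotypicComponent τ).toSubmodule] :
    Module.finrank ℂ (π.isotypicComponent τ).toSubmodule =
      Module.finrank ℂ E * Module.finrank ℂ (Schur.intertwiners τ π) := by
  haveI : FiniteDimensional ℂ (Schur.intertwiners τ π) := (finiteDimensional_intertwiners_iff hπu hτu).mpr inferInstance
  obtain ⟨Ψ, -⟩ := exists_linearEquiv_intertwiners_tensor_isotypicComponent' hπu hτu
  rw [← Ψ.finrank_eq, Module.finrank_tensorProduct, mul_comm]

/-- **`multiplicity π τ = dim_ℂ Hom_G(τ, π)` for ANY group** (`π` unitary, `τ` irreducible unitary, finite-dimensional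
isotype): Bröcker–tom Dieck's definition II (1.13) of the multiplicity agrees with the `HilbertRepSpectrum` one with no
compactness and no continuity. [cite: BrockerTomDieck1985, II Prop (1.14)] [cite: DeitmarEchterhoff2014, Thm. 7.3.2] -/
theorem multiplicity_eq_finrank_intertwiners'' (hπu : π.IsUnitary) [τ.toRepresentation.IsIrreducible]
    (hτu : ∀ (g : G) (v w : E), ⟪τ g v, τ g w⟫_ℂ = ⟪v, w⟫_ℂ) [FiniteDimensional ℂ (π.isotypicComponent τ).toSubmodule] :
    π.multiplicity τ = (Module.finrank ℂ (Schur.intertwiners τ π) : ℕ∞) := by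
  haveI : Nontrivial E := IsSimpleModule.nontrivial (MonoidAlgebra ℂ G) τ.toRepresentation.asModule
  rw [hπu.multiplicity_eq_finrank_div, finrank_isotypicComponent_eq_finrank_mul_finrank_intertwiners' hπu hτu,
    Nat.mul_div_cancel_left _ Module.finrank_pos]

/-- **The multiplicity as a dimension, unconditionally, for any group**: either `Hom_G(τ, π)` is finite-dimensional and
`multiplicity π τ = dim Hom_G(τ, π)`, or it is infinite-dimensional and `multiplicity π τ = ⊤`.
[cite: BrockerTomDieck1985, II Prop (1.14)] [cite: DeitmarEchterhoff2014, Thm. 7.3.2] -/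
theorem multiplicity_eq_finrank_intertwiners_or' (hπu : π.IsUnitary) [τ.toRepresentation.IsIrreducible]
    (hτu : ∀ (g : G) (v w : E), ⟪τ g v, τ g w⟫_ℂ = ⟪v, w⟫_ℂ) :
    (FiniteDimensional ℂ (Schur.intertwiners τ π) ∧
        π.multiplicity τ = (Module.finrank ℂ (Schur.intertwiners τ π) : ℕ∞)) ∨
      (¬ FiniteDimensional ℂ (Schur.intertwiners τ π) ∧ π.multiplicity τ = ⊤) := by
  by_cases hfin : FiniteDimensional ℂ (Schur.intertwiners τ π)
  · left
    haveI := (finiteDimensional_intertwiners_iff hπu hτu).mp hfin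
    exact ⟨hfin, multiplicity_eq_finrank_intertwiners'' hπu hτu⟩
  · right
    exact ⟨hfin, (multiplicity_eq_top_iff_not_finiteDimensional_intertwiners hπu hτu).mpr hfin⟩

/-- The same count in the Hilbert–Schmidt model: **`multiplicity π τ = dim HomSpace τ π`** (finite-dimensional isotype,
any group). [cite: DeitmarEchterhoff2014, Thm. 7.3.2] -/
theorem multiplicity_eq_finrank_homSpace (hπu : π.IsUnitary) [τ.toRepresentation.IsIrreducible]
    (hτu : ∀ (g : G) (v w : E), ⟪τ g v, τ g w⟫_ℂ = ⟪v, w⟫_ℂ) [FiniteDimensional ℂ (π.isotypicComponent τ).toSubmodule] :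
    π.multiplicity τ = (Module.finrank ℂ (HomSpace τ π) : ℕ∞) :=
  multiplicity_eq_finrank_intertwiners'' hπu hτu

end AnyGroup

/-! ### Product groups: `mult(π ⊗ τ, U) = mult(π, Θ(τ))` without compactness -/

section Product

variable {G H : Type*} [Group G] [Group H]
variable {X : Type*} [NormedAddCommGroup X] [InnerProductSpace ℂ X] [CompleteSpace X]
variable {E F : Type*} [NormedAddCommGroup E] [InnerProductSpace ℂ E] [FiniteDimensional ℂ E]
  [NormedAddCommGroup F] [InnerProductSpace ℂ F] [FiniteDimensional ℂ F]
variable {U : ContRepresentation ℂ (G × H) X} {π : ContRepresentation ℂ G E} {τ : ContRepresentation ℂ H F}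

/-- **`mult(π ⊗ τ, U) = mult(π, Θ(τ))` for ANY groups `G`, `H`** — `U` unitary on a Hilbert space, `π`, `τ` irreducible
unitary (finite-dimensional) with `π ⊗ τ` irreducible: both sides are `dim Hom` (`curryEquiv`:
`Hom_{G×H}(π ⊗ τ, U) ≃ₗ Hom_G(π, Θ(τ))`) when finite and `⊤` otherwise (Bröcker–tom Dieck II (4.14), proof:
`U ≅ ⊕ n_ij V_i ⊗ W_j` with `Hom_H(W_j, U) = ⊕_i n_ij V_i`). [cite: BrockerTomDieck1985, II Prop (4.14)] -/
theorem multiplicity_outerTensor_eq_multiplicity_homRep' (hUu : U.IsUnitary)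
    [π.toRepresentation.IsIrreducible] [(π.outerTensor τ).toRepresentation.IsIrreducible]
    (hπu : ∀ (g : G) (v w : E), ⟪π g v, π g w⟫_ℂ = ⟪v, w⟫_ℂ) (hτu : ∀ (h : H) (v w : F), ⟪τ h v, τ h w⟫_ℂ = ⟪v, w⟫_ℂ) :
    U.multiplicity (π.outerTensor τ) = (U.homRep τ).multiplicity π := by
  haveI : CompleteSpace (E ⊗[ℂ] F) := FiniteDimensional.complete ℂ (E ⊗[ℂ] F)
  have hπτu := ContRepresentation.inner_outerTensor_apply_apply π τ hπu hτu
  have hΘu : (U.homRep τ).IsUnitary := isUnitary_homRep hUu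
  by_cases hfin : FiniteDimensional ℂ (Schur.intertwiners (π.outerTensor τ) U)
  · haveI := hfin
    haveI : FiniteDimensional ℂ (Schur.intertwiners π (U.homRep τ)) :=
      (finiteDimensional_intertwiners_outerTensor_iff (U := U) (π := π) (τ := τ)).mp hfin
    haveI := (finiteDimensional_intertwiners_iff hUu hπτu).mp hfin
    haveI := (finiteDimensional_intertwiners_iff hΘu hπu).mp
      (inferInstance : FiniteDimensional ℂ (Schur.intertwiners π (U.homRep τ)))
    rw [multiplicity_eq_finrank_intertwiners'' hUu hπτu, multiplicity_eq_finrank_intertwiners'' hΘu hπu,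
      finrank_intertwiners_outerTensor_eq_finrank_intertwiners_homRep]
  · have hfin' : ¬ FiniteDimensional ℂ (Schur.intertwiners π (U.homRep τ)) := fun h =>
      hfin ((finiteDimensional_intertwiners_outerTensor_iff (U := U) (π := π) (τ := τ)).mpr h)
    rw [(multiplicity_eq_top_iff_not_finiteDimensional_intertwiners hUu hπτu).mpr hfin,
      (multiplicity_eq_top_iff_not_finiteDimensional_intertwiners hΘu hπu).mpr hfin']

end Product

/-! ### Occurrence: `τ` occurs in `π` iff `Hom_G(τ, π) ≠ 0` — any group -/

section Occurrence

variable {G : Type*} [Group G]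
variable {X : Type*} [NormedAddCommGroup X] [InnerProductSpace ℂ X] [CompleteSpace X]
variable {E : Type*} [NormedAddCommGroup E] [InnerProductSpace ℂ E] [FiniteDimensional ℂ E]
variable {π : ContRepresentation ℂ G X} {τ : ContRepresentation ℂ G E}

/-- **`Hom_G(τ, π) = 0` iff the isotype `X_τ(π)` vanishes** (`π` unitary, `τ` irreducible unitary; any group): the isotype
is the closed span of the ranges of the intertwiners (`toSubmodule_isotypicComponent_eq_closure_iSup_range`) and every
intertwiner maps into it. [cite: DeitmarEchterhoff2014, Thm. 7.3.2] [cite: BrockerTomDieck1985, II Prop (1.14)] -/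
theorem intertwiners_eq_bot_iff_isotypicComponent_eq_bot (hπu : π.IsUnitary) [τ.toRepresentation.IsIrreducible]
    (hτu : ∀ (g : G) (v w : E), ⟪τ g v, τ g w⟫_ℂ = ⟪v, w⟫_ℂ) :
    Schur.intertwiners τ π = ⊥ ↔ π.isotypicComponent τ = ⊥ := by
  constructor
  · intro h
    have hsub : (π.isotypicComponent τ).toSubmodule = ⊥ := by
      rw [toSubmodule_isotypicComponent_eq_closure_iSup_range hπu hτu]
      have hsup : (⨆ T : Schur.intertwiners τ π, LinearMap.range ((T : E →L[ℂ] X) : E →ₗ[ℂ] X)) = ⊥ := by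
        refine iSup_eq_bot.mpr fun T => ?_
        have hT : (T : E →L[ℂ] X) = 0 := by
          have hmem : (T : E →L[ℂ] X) ∈ (⊥ : Submodule ℂ (E →L[ℂ] X)) := h ▸ T.2
          rwa [Submodule.mem_bot] at hmem
        rw [hT, ContinuousLinearMap.toLinearMap_zero, LinearMap.range_zero]
      rw [hsup]
      exact (Submodule.closed_of_finiteDimensional (⊥ : Submodule ℂ X)).submodule_topologicalClosure_eq
    refine ClosedSubrep.ext fun v => ?_
    rw [← ClosedSubrep.mem_toSubmodule, hsub, ← ClosedSubrep.mem_toSubmodule, ClosedSubrep.toSubmodule_bot]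
  · intro h
    rw [Submodule.eq_bot_iff]
    intro T hT
    refine ContinuousLinearMap.ext fun f => ?_
    have hmem := apply_mem_isotypicComponent_of_mem_intertwiners hπu hτu hT f
    rw [h, ← ClosedSubrep.mem_toSubmodule, ClosedSubrep.toSubmodule_bot, Submodule.mem_bot] at hmem
    rw [hmem, _root_.zero_apply]

/-- **`multiplicity π τ = 0` iff `Hom_G(τ, π) = 0`** — `τ` occurs in `π` iff there is a non-zero `G`-map `τ → π`
(any group; `π` unitary, `τ` irreducible unitary). [cite: DeitmarEchterhoff2014, Thm. 7.3.2] [cite: BrockerTomDieck1985, II Prop (1.14)] -/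
theorem multiplicity_eq_zero_iff_intertwiners_eq_bot (hπu : π.IsUnitary) [τ.toRepresentation.IsIrreducible]
    (hτu : ∀ (g : G) (v w : E), ⟪τ g v, τ g w⟫_ℂ = ⟪v, w⟫_ℂ) :
    π.multiplicity τ = 0 ↔ Schur.intertwiners τ π = ⊥ := by
  haveI : Nontrivial E := IsSimpleModule.nontrivial (MonoidAlgebra ℂ G) τ.toRepresentation.asModule
  rw [hπu.multiplicity_eq_zero_iff, intertwiners_eq_bot_iff_isotypicComponent_eq_bot hπu hτu]

/-- **`multiplicity π τ ≠ 0` iff the multiplicity space `Hom_G(τ, π)` is non-trivial.**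
[cite: DeitmarEchterhoff2014, Thm. 7.3.2] [cite: BrockerTomDieck1985, II Prop (1.14)] -/
theorem multiplicity_ne_zero_iff_nontrivial_intertwiners (hπu : π.IsUnitary) [τ.toRepresentation.IsIrreducible]
    (hτu : ∀ (g : G) (v w : E), ⟪τ g v, τ g w⟫_ℂ = ⟪v, w⟫_ℂ) :
    π.multiplicity τ ≠ 0 ↔ Nontrivial (Schur.intertwiners τ π) := by
  rw [Ne, multiplicity_eq_zero_iff_intertwiners_eq_bot hπu hτu]
  exact Submodule.nontrivial_iff_ne_bot.symm

/-- The same for the Hilbert–Schmidt model: **`Θ(τ) = HomSpace τ π` is non-trivial iff `multiplicity π τ ≠ 0`.**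
[cite: DeitmarEchterhoff2014, Thm. 7.3.2] -/
theorem nontrivial_homSpace_iff_multiplicity_ne_zero (hπu : π.IsUnitary) [τ.toRepresentation.IsIrreducible]
    (hτu : ∀ (g : G) (v w : E), ⟪τ g v, τ g w⟫_ℂ = ⟪v, w⟫_ℂ) :
    Nontrivial (HomSpace τ π) ↔ π.multiplicity τ ≠ 0 :=
  (multiplicity_ne_zero_iff_nontrivial_intertwiners hπu hτu).symm

end Occurrence

end ContRepresentation

end
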